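import Literature.MathematicalPhysics.QuantumFieldTheory.Balaban1983to89.BlockAveragingSectionPlaq

/-!
# Route `UnitScaleTilt` — crux K1bR-pr `FluctuationComparisonRegPr` (stmt-QuantumFields-19201), stub `stub_oneStepSmallLift`
# (W7 line), piece (L2-iii)(a), first layer: THE PLAQUETTE VARIABLES OF A LEFT-MULTIPLIED CONFIGURATION `E · W`
# (support file `--supports stmt-QuantumFields-19201`)

Cell `ym3-torus` (rung R3), seat `ym3-torus-p2` gen 8; CARD-19201-oneStepSmallLift-L1L2.md §2 (evidence on the item).  The approximate lift of
the card is `U⋆ = (exp ζ) · faceSec V`.  This file records the EXACT group identity behind its plaquette expansion and the resulting crude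
(triangle) bound, for every gauge group:

* `plaqHol_mul_left`: `(E·W)(∂p) = [E₁ · Ad_{T₁}E₂ · Ad_{T₃}E₃⁻¹ · Ad_{T₄}E₄⁻¹] · W(∂p)` with the partial transports `T₁ = W₁`, `T₃ = W₁W₂W₃⁻¹`,
  `T₄ = W(∂p)` of `W` along `∂p` — the bracket is the TWISTED COBOUNDARY of `E` around `p` (its linearisation is `(d_W ζ)(p)` for `E = exp ζ`);
* `dist1_plaqHol_mul_left_le`: `dist1 ((E·W)(∂p)) ≤ Σ_{b∈∂p} dist1 (E b) + dist1 (W(∂p))`;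
* `dist1_plaqHol_mul_faceSec_le`: for `W = faceSec V` the last term is `dist1 (V(∂p′))` on the `L` edge plaquettes of the coarse plaquette `p′`
  and `0` elsewhere (`BlockAveragingSectionPlaq.plaqHol_faceSec`), so `PlaqSmall δ V`, `dist1 (E b) ≤ ε` give `dist1 ((E·faceSec V)(∂p)) < 4ε + δ`.
The second-order refinement (cancellation inside the bracket: `dist1 ≤ ‖Σ ± Ad ζ‖ + C·(Σ‖ζ‖)²`) is the content of (L2-iii) proper.

Elementary; nothing of Bałaban's is asserted.
-/

noncomputable section

namespace Summit.QuantumFields.YangMills.Theorems.ApproxLift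

open Literature.MathematicalPhysics.QuantumFieldTheory.Balaban1983to89
open Literature.MathematicalPhysics.QuantumFieldTheory.Balaban1983to89.BlockAveragingSection

variable {P : Params} {j : ℕ} {G : Type*} [GaugeGroup G]

/-- The bondwise product configuration `(E · W)(b) = E(b) W(b)`. -/
def mulField (E W : GaugeField P j G) : GaugeField P j G := fun b => E b * W b

/-- Evaluation of `mulField`. -/
@[simp] theorem mulField_apply (E W : GaugeField P j G) (b : PBond P j) : mulField E W b = E b * W b := rfl

/-- The TWISTED COBOUNDARY of `E` around the plaquette `p` with respect to the transports of `W`: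
`E₁ · (T₁ E₂ T₁⁻¹) · (T₃ E₃⁻¹ T₃⁻¹) · (T₄ E₄⁻¹ T₄⁻¹)`, `T₁ = W₁`, `T₃ = W₁W₂W₃⁻¹`, `T₄ = W(∂p)` (bonds in the order of `GaugeField.plaqHol`). -/
def twistedCobd (E W : GaugeField P j G) (p : Plaq P j) : G :=
  E ⟨p.src, p.μ⟩ *
    (W ⟨p.src, p.μ⟩ * E ⟨p.src.shift p.μ, p.ν⟩ * (W ⟨p.src, p.μ⟩)⁻¹) *
    (W ⟨p.src, p.μ⟩ * W ⟨p.src.shift p.μ, p.ν⟩ * (W ⟨p.src.shift p.ν, p.μ⟩)⁻¹ * (E ⟨p.src.shift p.ν, p.μ⟩)⁻¹ *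
      (W ⟨p.src, p.μ⟩ * W ⟨p.src.shift p.μ, p.ν⟩ * (W ⟨p.src.shift p.ν, p.μ⟩)⁻¹)⁻¹) *
    (GaugeField.plaqHol W p * (E ⟨p.src, p.ν⟩)⁻¹ * (GaugeField.plaqHol W p)⁻¹)

/-- **THE PLAQUETTE OF A LEFT-MULTIPLIED CONFIGURATION** (exact identity in any group):
`(E·W)(∂p) = twistedCobd E W p · W(∂p)`. -/
theorem plaqHol_mul_left (E W : GaugeField P j G) (p : Plaq P j) :
    GaugeField.plaqHol (mulField E W) p = twistedCobd E W p * GaugeField.plaqHol W p := by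
  simp only [GaugeField.plaqHol, twistedCobd, mulField_apply, mul_inv_rev]
  group

/-- The twisted coboundary is within `Σ_{b∈∂p} dist1 (E b)` of `1` (triangle inequality; conjugation and inversion invariance of `dist1`). -/
theorem dist1_twistedCobd_le (E W : GaugeField P j G) (p : Plaq P j) :
    dist1 (twistedCobd E W p) ≤ dist1 (E ⟨p.src, p.μ⟩) + dist1 (E ⟨p.src.shift p.μ, p.ν⟩) +
      dist1 (E ⟨p.src.shift p.ν, p.μ⟩) + dist1 (E ⟨p.src, p.ν⟩) := by
  unfold twistedCobd
  have h2 : dist1 (W ⟨p.src, p.μ⟩ * E ⟨p.src.shift p.μ, p.ν⟩ * (W ⟨p.src, p.μ⟩)⁻¹) = dist1 (E ⟨p.src.shift p.μ, p.ν⟩) :=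
    GaugeGroup.dist1_conj _ _
  have h3 : dist1 (W ⟨p.src, p.μ⟩ * W ⟨p.src.shift p.μ, p.ν⟩ * (W ⟨p.src.shift p.ν, p.μ⟩)⁻¹ * (E ⟨p.src.shift p.ν, p.μ⟩)⁻¹ *
      (W ⟨p.src, p.μ⟩ * W ⟨p.src.shift p.μ, p.ν⟩ * (W ⟨p.src.shift p.ν, p.μ⟩)⁻¹)⁻¹) = dist1 (E ⟨p.src.shift p.ν, p.μ⟩) := by
    rw [GaugeGroup.dist1_conj, GaugeGroup.dist1_inv]
  have h4 : dist1 (GaugeField.plaqHol W p * (E ⟨p.src, p.ν⟩)⁻¹ * (GaugeField.plaqHol W p)⁻¹) = dist1 (E ⟨p.src, p.ν⟩) := by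
    rw [GaugeGroup.dist1_conj, GaugeGroup.dist1_inv]
  calc _ ≤ dist1 (E ⟨p.src, p.μ⟩ * (W ⟨p.src, p.μ⟩ * E ⟨p.src.shift p.μ, p.ν⟩ * (W ⟨p.src, p.μ⟩)⁻¹) *
          (W ⟨p.src, p.μ⟩ * W ⟨p.src.shift p.μ, p.ν⟩ * (W ⟨p.src.shift p.ν, p.μ⟩)⁻¹ * (E ⟨p.src.shift p.ν, p.μ⟩)⁻¹ *
            (W ⟨p.src, p.μ⟩ * W ⟨p.src.shift p.μ, p.ν⟩ * (W ⟨p.src.shift p.ν, p.μ⟩)⁻¹)⁻¹)) +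
        dist1 (GaugeField.plaqHol W p * (E ⟨p.src, p.ν⟩)⁻¹ * (GaugeField.plaqHol W p)⁻¹) := GaugeGroup.dist1_mul_le _ _
    _ ≤ (dist1 (E ⟨p.src, p.μ⟩ * (W ⟨p.src, p.μ⟩ * E ⟨p.src.shift p.μ, p.ν⟩ * (W ⟨p.src, p.μ⟩)⁻¹)) +
          dist1 (W ⟨p.src, p.μ⟩ * W ⟨p.src.shift p.μ, p.ν⟩ * (W ⟨p.src.shift p.ν, p.μ⟩)⁻¹ * (E ⟨p.src.shift p.ν, p.μ⟩)⁻¹ *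
            (W ⟨p.src, p.μ⟩ * W ⟨p.src.shift p.μ, p.ν⟩ * (W ⟨p.src.shift p.ν, p.μ⟩)⁻¹)⁻¹)) +
        dist1 (GaugeField.plaqHol W p * (E ⟨p.src, p.ν⟩)⁻¹ * (GaugeField.plaqHol W p)⁻¹) := by
          gcongr; exact GaugeGroup.dist1_mul_le _ _
    _ ≤ ((dist1 (E ⟨p.src, p.μ⟩) + dist1 (W ⟨p.src, p.μ⟩ * E ⟨p.src.shift p.μ, p.ν⟩ * (W ⟨p.src, p.μ⟩)⁻¹)) +
          dist1 (W ⟨p.src, p.μ⟩ * W ⟨p.src.shift p.μ, p.ν⟩ * (W ⟨p.src.shift p.ν, p.μ⟩)⁻¹ * (E ⟨p.src.shift p.ν, p.μ⟩)⁻¹ *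
            (W ⟨p.src, p.μ⟩ * W ⟨p.src.shift p.μ, p.ν⟩ * (W ⟨p.src.shift p.ν, p.μ⟩)⁻¹)⁻¹)) +
        dist1 (GaugeField.plaqHol W p * (E ⟨p.src, p.ν⟩)⁻¹ * (GaugeField.plaqHol W p)⁻¹) := by
          gcongr; exact GaugeGroup.dist1_mul_le _ _
    _ = _ := by rw [h2, h3, h4]

/-- **CRUDE PLAQUETTE BOUND FOR `E · W`**: `dist1 ((E·W)(∂p)) ≤ Σ_{b∈∂p} dist1 (E b) + dist1 (W(∂p))`. -/
theorem dist1_plaqHol_mul_left_le (E W : GaugeField P j G) (p : Plaq P j) :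
    dist1 (GaugeField.plaqHol (mulField E W) p) ≤ dist1 (E ⟨p.src, p.μ⟩) + dist1 (E ⟨p.src.shift p.μ, p.ν⟩) +
      dist1 (E ⟨p.src.shift p.ν, p.μ⟩) + dist1 (E ⟨p.src, p.ν⟩) + dist1 (GaugeField.plaqHol W p) := by
  rw [plaqHol_mul_left]
  exact (GaugeGroup.dist1_mul_le _ _).trans (by linarith [dist1_twistedCobd_le E W p])

/-- **CRUDE PLAQUETTE BOUND FOR A FACE-SECTION-BASED LIFT**: if every `E(b)` is within `ε` of `1` and `V` is `δ`-small, every plaquette of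
`E · faceSec V` is within `4ε + δ` of `1` (`< `, as `PlaqSmall` demands).  The refined bound with the cancellation inside the twisted coboundary
is (L2-iii) of the card. -/
theorem plaqSmall_mulField_faceSec (hj : j + 1 ≤ P.m + P.K) {ε δ : ℝ} (hδ : 0 < δ) {E : GaugeField P j G} {V : GaugeField P (j + 1) G}
    (hE : ∀ b, dist1 (E b) ≤ ε) (hV : PlaqSmall δ V) : PlaqSmall (4 * ε + δ) (mulField E (faceSec V)) := by
  intro p
  have h := dist1_plaqHol_mul_left_le E (faceSec V) p
  have hW : dist1 (GaugeField.plaqHol (faceSec V) p) < δ := BlockAveragingSectionPlaq.plaqSmall_faceSec hj hδ hV p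
  linarith [hE ⟨p.src, p.μ⟩, hE ⟨p.src.shift p.μ, p.ν⟩, hE ⟨p.src.shift p.ν, p.μ⟩, hE ⟨p.src, p.ν⟩]

end Summit.QuantumFields.YangMills.Theorems.ApproxLift

end
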